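import Mathlib
import Summits.CriticalPhenomena.CardyFormulaZ2.Theorems.CardyMagicRigidityNestingRigidityUVExpMomentsChargeFree
import Summits.CriticalPhenomena.CardyFormulaZ2.Theorems.CardyMagicRigidityNestingRigidityFusionCloudCarriers
import HarnessLib

/-!
# Crux `NestingRigidity`, line `positive-cone-weight-doubling`: pathwise domination of the squared
# far bites by dyadic big-loop counts (the deterministic half of Ξ₂)

Crux `Summit.CriticalPhenomena.CardyFormulaZ2.Theses.CardyMagicRigidity.NestingRigidity`
(stmt-CriticalPhenomena-4835), line `positive-cone-weight-doubling`, registered helper Ξ₂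
`uvFarBiteSq_expMoment_latticeEnsembles`: `E_δ exp(a Σ_{far u} (φ_u − ψ_u)²) ≤ C` for all `a > 0`,
where the far loops are those with trace off `A* = B̄(0, 1+2δ) ∖ B(0, r−2δ)` and `φ_u`, `ψ_u` are the
fractions of the disc `B(0, r)` and of the ring `{1 ≤ |z| < 2}` inside the winding interior.  This
file is the deterministic half (no probability beyond a Fatou-type lemma, no cited fact, no
definition):

* §1 DYADIC CLASSES: `min(1, t⁴) ≤ Σ_{k<n} 16^{-k}·1[2^{-k-1} ≤ t]` as soon as one class `k < n`
  is available, whence for a finite family with diameters `d_u` (all positive ones `≥ ρ/2^n`)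
  `Σ_u min(1, (d_u/ρ)⁴) ≤ Σ_{k<n} 16^{-k}·#{u : ρ/2^{k+1} ≤ d_u}` (`sum_min_le_sum_card`);
* §2 a FATOU-TYPE LEMMA: a nonnegative measurable `f` dominated pointwise by SOME member of a monotone
  sequence `g_n` with `∫ g_n ≤ C` is integrable with `∫ f ≤ C` (monotone convergence for `∫⁻`);
* §3 PER-LOOP GEOMETRY (registered anchor `farBiteSq_le_latticeEnsembles`, stated for all loops):
  a far loop lies inside `B(0, r−2δ)` or outside `B̄(0, 1+2δ)` (the trace is connected); an inner
  loop has `(φ_u − ψ_u)² = φ_u² ≤ min(1, diam⁴/r⁴)` (`ψ_u = 0`, `φ_u ≤ diam²/r²`,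
  `TiltTransfer.discFrac_le_diam_sq_div`); an outer loop has `(φ_u − ψ_u)² ≤ min(1, diam⁴)` (either
  it winds around `0`, and then `diam > 1`, or it does not, and then `φ_u = 0`, `ψ_u ≤ diam²/3`); a
  loop with a nonzero bite meets `B̄(0, 2)`.
-/

noncomputable section

open MeasureTheory Set Filter Metric
open scoped Real Topology BigOperators ENNReal

namespace Summit.CriticalPhenomena.CardyFormulaZ2.Cruxes.NestingRigidity.PositiveConeWeightDoubling

open Literature.Probability.RandomPlanarGeometry Literature.Probability.Percolation
  Literature.Probability.LatticeModels
open Summit.CriticalPhenomena.CardyFormulaZ2.Cruxes.NestingRigidity.RingCloudTomography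

namespace UVFarBiteSq

/-! ## §1 Dyadic classes of a diameter -/

/-- **Dyadic class bound**: if some class `k < n` is available for `t ≥ 0` (`2^{-k-1} ≤ t`), then
`min(1, t⁴) ≤ Σ_{k<n} 16^{-k}·1[2^{-k-1} ≤ t]` (the first available class `j` alone dominates:
`t < 2^{-j}` unless `j = 0`). -/
theorem min_one_pow_four_le_sum {t : ℝ} (ht : 0 ≤ t) {n : ℕ} (hn : ∃ k < n, 1 / (2 : ℝ) ^ (k + 1) ≤ t) :
    min 1 (t ^ 4) ≤ ∑ k ∈ Finset.range n, if 1 / (2 : ℝ) ^ (k + 1) ≤ t then 1 / (16 : ℝ) ^ k else 0 := by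
  classical
  obtain ⟨k₀, hk₀n, hk₀⟩ := hn
  have hex : ∃ k, 1 / (2 : ℝ) ^ (k + 1) ≤ t := ⟨k₀, hk₀⟩
  have hjt : 1 / (2 : ℝ) ^ (Nat.find hex + 1) ≤ t := Nat.find_spec hex
  have hjn : Nat.find hex ∈ Finset.range n :=
    Finset.mem_range.2 (lt_of_le_of_lt (Nat.find_min' hex hk₀) hk₀n)
  have hterm : min 1 (t ^ 4) ≤
      (if 1 / (2 : ℝ) ^ (Nat.find hex + 1) ≤ t then 1 / (16 : ℝ) ^ Nat.find hex else 0) := by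
    rw [if_pos hjt]
    rcases Nat.eq_zero_or_pos (Nat.find hex) with hj0 | hjpos
    · rw [hj0, pow_zero, div_one]
      exact min_le_left _ _
    · have hmin : ¬ (1 / (2 : ℝ) ^ (Nat.find hex - 1 + 1) ≤ t) := Nat.find_min hex (by omega)
      rw [Nat.sub_add_cancel hjpos, not_le] at hmin
      refine (min_le_right _ _).trans ?_
      have h : t ^ 4 ≤ (1 / (2 : ℝ) ^ Nat.find hex) ^ 4 := pow_le_pow_left₀ ht hmin.le 4
      refine h.trans (le_of_eq ?_)
      rw [div_pow, one_pow, ← pow_mul, show (2 : ℝ) ^ (Nat.find hex * 4) = 16 ^ Nat.find hex by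
        rw [mul_comm, pow_mul]; norm_num]
  exact hterm.trans (Finset.single_le_sum
    (f := fun k ↦ if 1 / (2 : ℝ) ^ (k + 1) ≤ t then 1 / (16 : ℝ) ^ k else 0)
    (fun k _ ↦ by split_ifs <;> positivity) hjn)

/-- **Dyadic domination of a finite family**: if every positive diameter of the family is
`≥ ρ/2^n` (`0 < n`), then `Σ_u min(1, (d_u/ρ)⁴) ≤ Σ_{k<n} 16^{-k}·#{u : ρ/2^{k+1} ≤ d_u}`. -/
theorem sum_min_le_sum_card {α : Type*} (F : Finset α) (d : α → ℝ) {ρ : ℝ} (hρ : 0 < ρ)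
    (hd : ∀ u ∈ F, 0 ≤ d u) {n : ℕ} (hn : 0 < n) (hF : ∀ u ∈ F, 0 < d u → ρ / 2 ^ n ≤ d u) :
    ∑ u ∈ F, min 1 ((d u / ρ) ^ 4) ≤
      ∑ k ∈ Finset.range n, 1 / (16 : ℝ) ^ k * ((F.filter fun u ↦ ρ / 2 ^ (k + 1) ≤ d u).card : ℝ) := by
  classical
  have hiff : ∀ (u : α) (k : ℕ), (1 / (2 : ℝ) ^ (k + 1) ≤ d u / ρ) ↔ (ρ / 2 ^ (k + 1) ≤ d u) := by
    intro u k
    rw [show ρ / 2 ^ (k + 1) = 1 / 2 ^ (k + 1) * ρ by ring]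
    exact le_div_iff₀ hρ
  have hterm : ∀ u ∈ F, min 1 ((d u / ρ) ^ 4) ≤
      ∑ k ∈ Finset.range n, if ρ / 2 ^ (k + 1) ≤ d u then 1 / (16 : ℝ) ^ k else 0 := by
    intro u hu
    rcases (hd u hu).eq_or_lt with h0 | hpos
    · rw [← h0, zero_div, zero_pow four_ne_zero, min_eq_right zero_le_one]
      exact Finset.sum_nonneg fun k _ ↦ by split_ifs <;> positivity
    · have h := min_one_pow_four_le_sum (div_nonneg (hd u hu) hρ.le) (n := n)
        ⟨n - 1, by omega, by rw [hiff, Nat.sub_add_cancel hn]; exact hF u hu hpos⟩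
      simp_rw [hiff] at h
      exact h
  calc ∑ u ∈ F, min 1 ((d u / ρ) ^ 4)
      ≤ ∑ u ∈ F, ∑ k ∈ Finset.range n, (if ρ / 2 ^ (k + 1) ≤ d u then 1 / (16 : ℝ) ^ k else 0) :=
        Finset.sum_le_sum hterm
    _ = ∑ k ∈ Finset.range n, ∑ u ∈ F, (if ρ / 2 ^ (k + 1) ≤ d u then 1 / (16 : ℝ) ^ k else 0) :=
        Finset.sum_comm
    _ = _ := by
        refine Finset.sum_congr rfl fun k _ ↦ ?_
        rw [← Finset.sum_filter, Finset.sum_const, nsmul_eq_mul, mul_comm]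

/-! ## §2 A Fatou-type lemma -/

/-- **Domination by some member of a monotone sequence.**  On a finite measure space, a nonnegative
measurable `f` such that every point is dominated by SOME member of a pointwise monotone sequence of
nonnegative integrable `g_n` with `∫ g_n ≤ C` is integrable with `∫ f ≤ C` (monotone convergence
for the lower integrals of `g_n`). -/
theorem integral_le_of_le_some {Ω : Type*} [MeasurableSpace Ω] {μ : Measure Ω} [IsFiniteMeasure μ]
    {f : Ω → ℝ} {g : ℕ → Ω → ℝ} {C : ℝ} (hfm : Measurable f) (hf0 : ∀ ω, 0 ≤ f ω)
    (hgm : ∀ n, Measurable (g n)) (hg0 : ∀ n ω, 0 ≤ g n ω) (hmono : ∀ ω, Monotone fun n ↦ g n ω)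
    (hfg : ∀ ω, ∃ n, f ω ≤ g n ω) (hgi : ∀ n, Integrable (g n) μ) (hgC : ∀ n, ∫ ω, g n ω ∂μ ≤ C) :
    Integrable f μ ∧ ∫ ω, f ω ∂μ ≤ C := by
  have hC : 0 ≤ C := (integral_nonneg (hg0 0)).trans (hgC 0)
  have key : ∫⁻ ω, ENNReal.ofReal (f ω) ∂μ ≤ ENNReal.ofReal C := by
    calc ∫⁻ ω, ENNReal.ofReal (f ω) ∂μ ≤ ∫⁻ ω, ⨆ n, ENNReal.ofReal (g n ω) ∂μ :=
          lintegral_mono fun ω ↦ by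
            obtain ⟨n, hn⟩ := hfg ω
            exact le_iSup_of_le n (ENNReal.ofReal_le_ofReal hn)
      _ = ⨆ n, ∫⁻ ω, ENNReal.ofReal (g n ω) ∂μ :=
          lintegral_iSup (fun n ↦ (hgm n).ennreal_ofReal) fun n m hnm ω ↦
            ENNReal.ofReal_le_ofReal (hmono ω hnm)
      _ ≤ ENNReal.ofReal C := iSup_le fun n ↦ by
          rw [← ofReal_integral_eq_lintegral_ofReal (hgi n) (Eventually.of_forall (hg0 n))]
          exact ENNReal.ofReal_le_ofReal (hgC n)
  have hint : Integrable f μ := ⟨hfm.aestronglyMeasurable,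
    (hasFiniteIntegral_iff_ofReal (Eventually.of_forall hf0)).2 (lt_of_le_of_lt key ENNReal.ofReal_lt_top)⟩
  refine ⟨hint, ?_⟩
  rw [integral_eq_lintegral_of_nonneg_ae (Eventually.of_forall hf0) hfm.aestronglyMeasurable,
    ← ENNReal.toReal_ofReal hC]
  exact ENNReal.toReal_mono ENNReal.ofReal_ne_top key

/-! ## §3 Per-loop geometry of the far bites -/

/-- **A far loop is an inner loop or an outer loop**: a loop whose trace misses
`B̄(0, R₂) ∖ B(0, R₁)` (`R₁ ≤ R₂`) lies inside `B(0, R₁)` or outside `B̄(0, R₂)` (the trace is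
preconnected, `FusionCloud.isPreconnected_range`). -/
theorem range_subset_or_of_disjoint {u : UnbasedLoop ℂ} {R₁ R₂ : ℝ} (hR : R₁ ≤ R₂)
    (h : Disjoint u.range (closedBall (0 : ℂ) R₂ \ ball 0 R₁)) :
    u.range ⊆ ball (0 : ℂ) R₁ ∨ u.range ⊆ (closedBall (0 : ℂ) R₂)ᶜ := by
  refine (FusionCloud.isPreconnected_range u).subset_or_subset isOpen_ball isClosed_closedBall.isOpen_compl
    (Set.disjoint_left.2 fun z hz hz' ↦ hz' (ball_subset_closedBall (ball_subset_ball hR hz))) fun z hz ↦ ?_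
  by_cases hzb : z ∈ ball (0 : ℂ) R₁
  · exact Or.inl hzb
  · exact Or.inr fun hzc ↦ Set.disjoint_left.1 h hz ⟨hzc, hzb⟩

/-- **Inner loops**: a loop inside `B(0, r)` (`0 < r ≤ 1`) does not bite the ring and bites at most
`min(1, diam²/r²)` of the disc, so `(φ_u − ψ_u)² ≤ min(1, diam⁴/r⁴)`. -/
theorem biteSq_le_min_of_inner {u : UnbasedLoop ℂ} {r : ℝ} (hr : 0 < r) (hr1 : r ≤ 1)
    (hu : u.range ⊆ ball (0 : ℂ) r) :
    ((∫ z in {z | u.wind z ≠ 0}, discDensity 0 r z) - ∫ z in {z | u.wind z ≠ 0}, annulusDensity 0 1 2 z) ^ 2 ≤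
      min 1 ((diam u.range / r) ^ 4) := by
  obtain ⟨x, hx⟩ := u.range_nonempty
  have hψ : ∫ z in {z | u.wind z ≠ 0}, annulusDensity 0 1 2 z = 0 :=
    ConeTilt.setIntegral_annulusDensity_eq_zero_of_range_subset (hu.trans (ball_subset_ball hr1)) le_rfl 2
  have hφ := ConeTilt.setIntegral_discDensity_mem_Icc 0 hr {z | u.wind z ≠ 0}
  have hφd := TiltTransfer.discFrac_le_diam_sq_div u hr hx
  rw [hψ, sub_zero]
  refine le_min ?_ ?_
  · nlinarith [hφ.1, hφ.2]
  · have h := pow_le_pow_left₀ hφ.1 hφd 2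
    refine h.trans (le_of_eq ?_)
    rw [div_pow, div_pow, ← pow_mul, ← pow_mul]

/-- **Outer loops**: a loop outside `B̄(0, R)` (`r ≤ R`, `1 ≤ R`) has `(φ_u − ψ_u)² ≤ min(1, diam⁴)`:
if it winds around `0` its diameter exceeds `1`; otherwise it does not bite the disc `B(0, r)` and
bites at most `diam²/3` of the ring. -/
theorem biteSq_le_min_of_outer {u : UnbasedLoop ℂ} {r R : ℝ} (hr : 0 < r) (hrR : r ≤ R) (hR1 : 1 ≤ R)
    (hu : u.range ⊆ (closedBall (0 : ℂ) R)ᶜ) :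
    ((∫ z in {z | u.wind z ≠ 0}, discDensity 0 r z) - ∫ z in {z | u.wind z ≠ 0}, annulusDensity 0 1 2 z) ^ 2 ≤
      min 1 (diam u.range ^ 4) := by
  obtain ⟨x, hx⟩ := u.range_nonempty
  have h1 : ((∫ z in {z | u.wind z ≠ 0}, discDensity 0 r z) -
      ∫ z in {z | u.wind z ≠ 0}, annulusDensity 0 1 2 z) ^ 2 ≤ 1 := by
    have h := UVExpMoments.abs_bite_le_one hr u
    rw [← sq_abs]
    nlinarith [abs_nonneg ((∫ z in {z | u.wind z ≠ 0}, discDensity 0 r z) -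
      ∫ z in {z | u.wind z ≠ 0}, annulusDensity 0 1 2 z)]
  refine le_min h1 ?_
  have hxR : R < ‖x‖ := by
    have := hu hx
    rwa [Set.mem_compl_iff, mem_closedBall, dist_zero_right, not_le] at this
  by_cases hw : u.wind 0 ≠ 0
  · -- the loop winds around `0`: its diameter exceeds `1`
    have h0 := u.setOf_wind_ne_zero_subset_closedBall hx hw
    rw [mem_closedBall, dist_comm, dist_zero_right] at h0
    have hd : 1 ≤ diam u.range := by linarith
    exact h1.trans (one_le_pow₀ hd)
  · -- it does not: no disc bite, small ring bite
    push Not at hw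
    have hdisj : Disjoint u.range (closedBall (0 : ℂ) R) := Set.disjoint_left.2 fun z hz hz' ↦ hu hz hz'
    have hzero : ∀ z ∈ closedBall (0 : ℂ) R, u.wind z = 0 := fun z hz ↦ by
      rw [u.wind_eq_wind_of_disjoint hdisj hz (mem_closedBall_self (by linarith)), hw]
    have hφ : ∫ z in {z | u.wind z ≠ 0}, discDensity 0 r z = 0 :=
      ConeTilt.setIntegral_discDensity_eq_zero 0 r (Set.disjoint_left.2 fun z hz hz' ↦
        hz (hzero z (closedBall_subset_closedBall hrR (ball_subset_closedBall hz'))))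
    have hψ := ConeTilt.setIntegral_annulusDensity_mem_Icc 0 one_pos one_lt_two {z | u.wind z ≠ 0}
    have hψd := TiltTransfer.ringFrac_le_diam_sq_div u hx
    rw [hφ, zero_sub, neg_sq]
    have h := pow_le_pow_left₀ hψ.1 hψd 2
    refine h.trans ?_
    rw [div_pow, ← pow_mul]
    have : (0 : ℝ) ≤ diam u.range ^ (2 * 2) := by positivity
    linarith [div_le_self this (by norm_num : (1 : ℝ) ≤ 3 ^ 2)]

/-- **A loop with a nonzero bite meets `B̄(0, 2)`** (`0 < r ≤ 1`; the bite is the unit-charge cone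
phase, which vanishes off the loops meeting `B̄(0, 2)`, `UVLinear.cone_nestingPhase_eq_zero`). -/
theorem meets_of_bite_ne_zero {u : UnbasedLoop ℂ} {r : ℝ} (hr : 0 < r) (hr1 : r ≤ 1)
    (h : (∫ z in {z | u.wind z ≠ 0}, discDensity 0 r z) - ∫ z in {z | u.wind z ≠ 0}, annulusDensity 0 1 2 z ≠ 0) :
    (u.range ∩ closedBall (0 : ℂ) 2).Nonempty := by
  by_contra hn
  rw [UVExpMoments.bite_eq_nestingPhase_one] at h
  exact h (UVLinear.cone_nestingPhase_eq_zero hr hr1 hn)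

end UVFarBiteSq

open UVFarBiteSq in
/-- **Pathwise domination of the squared far bites, both lattice ensembles** (registered helper
toward Ξ₂ `uvFarBiteSq_expMoment_latticeEnsembles`, line `positive-cone-weight-doubling`; in fact a
statement about every loop).  For `0 < r ≤ 1`, `0 ≤ δ` and every loop `u` of `X_δ` whose trace misses
`A* = B̄(0, 1 + 2δ) ∖ B(0, r − 2δ)`: EITHER `u` is an inner loop — trace in `B(0, r − 2δ)` — and
`(φ_u − ψ_u)² ≤ min(1, diam(u)⁴/r⁴)`, OR `u` is an outer loop — trace off `B̄(0, 1 + 2δ)` — and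
`(φ_u − ψ_u)² ≤ min(1, diam(u)⁴)`, the bite vanishing unless the trace meets `B̄(0, 2)`. -/
theorem farBiteSq_le_latticeEnsembles : ∀ E ∈ latticeEnsembles, ∀ {r δ : ℝ}, 0 < r → r ≤ 1 → 0 ≤ δ →
    ∀ (ω : E.Ω), ∀ u ∈ {u ∈ (E.X δ ω).loops |
      Disjoint u.range (Metric.closedBall (0 : ℂ) (1 + 2 * δ) \ Metric.ball 0 (r - 2 * δ))},
      (u.range ⊆ Metric.ball (0 : ℂ) (r - 2 * δ) ∧
        ((∫ z in {z | u.wind z ≠ 0}, discDensity 0 r z) -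
          ∫ z in {z | u.wind z ≠ 0}, annulusDensity 0 1 2 z) ^ 2 ≤ min 1 ((Metric.diam u.range / r) ^ 4)) ∨
      (u.range ⊆ (Metric.closedBall (0 : ℂ) (1 + 2 * δ))ᶜ ∧
        ((∫ z in {z | u.wind z ≠ 0}, discDensity 0 r z) -
          ∫ z in {z | u.wind z ≠ 0}, annulusDensity 0 1 2 z) ^ 2 ≤ min 1 (Metric.diam u.range ^ 4) ∧
        (((∫ z in {z | u.wind z ≠ 0}, discDensity 0 r z) -
          ∫ z in {z | u.wind z ≠ 0}, annulusDensity 0 1 2 z) ≠ 0 →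
          (u.range ∩ Metric.closedBall (0 : ℂ) 2).Nonempty)) := by
  intro E _ r δ hr hr1 hδ ω u hu
  rcases range_subset_or_of_disjoint (by linarith) hu.2 with hin | hout
  · exact Or.inl ⟨hin, biteSq_le_min_of_inner hr hr1 (hin.trans (ball_subset_ball (by linarith)))⟩
  · exact Or.inr ⟨hout, biteSq_le_min_of_outer hr (by linarith) (by linarith) hout,
      meets_of_bite_ne_zero hr hr1⟩

end Summit.CriticalPhenomena.CardyFormulaZ2.Cruxes.NestingRigidity.PositiveConeWeightDoubling

end
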